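import Summits.ResolutionOfSingularities.ResolutionOfSingularities.Theorems.FrobeniusLadderFInjectiveMacaulayficationRegularOffCodimFourResidue
import HarnessLib

/-!
# Door v30 rung (T1-reg) IN EVERY LOCAL DIMENSION `≤ 3`: point-fix at a non-regular point whose proper generizations are regular,
# by the specialisation trick (crux `FInjectiveMacaulayfication` stmt-ResolutionOfSingularities-15315, chain w45a; res-L1-w45a-plan-1
# R15.27 (3) «dim 𝒪_η ≤ 2 HALF OF THE RUNG: GO — by the SAME specialisation trick, not Lipman/normalisation»; typed target =
# res-L1-w45a-strat-1 `FC2Dim4Sig.lean` v0.3 §2 `PointFixAtNonClosedOfRegular`; seat res-L1-w45a-stub-3)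

[OURS · L1 W4.5a] Support file (`--supports stmt-ResolutionOfSingularities-15315 --as helper`); NOT a statement of any manuscript; AI-written
(AI review is weaker than expert review). CONDITIONAL on `CossartPiltant2019General`, `Stacks081R`, `CossartPiltant2019Principalization` BY NAME.

* `pfix_of_isRegularLocalRing_generizations_of_le` — `X₁` integral of finite type over a field of characteristic `p`, `3 ≤ dim X₁`,
  `x ∈ X₁` with `dim 𝒪_{X₁,x} ≤ 3`, non-regular, with regular proper generizations ⇒ `TameWildSplit.PFixData p 𝒪_{X₁,x}`.
  PROOF: a specialisation `x′` of `x` with `dim 𝒪_{X₁,x′} = 3` (`RegularOffCodimFourResidue.exists_specializes_ringKrullDim_stalk_eq`);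
  Cossart–Piltant on `Z′ = Spec 𝒪_{X₁,x′}` (regular blowing up `T → Z′` along `𝓛`, `Supp 𝓛 = Sing Z′`); the point `q ∈ Z′` under `x` is
  singular and MAXIMAL in `Supp 𝓛` (local rings along `Spec 𝒪_{X₁,x′} → X₁` agree; proper generizations of `q` lie under proper
  generizations of `x`); `PointFixOfRegularGenerizations.pfixAt_stalk_of_isBlowup_of_isRegular` at `q`; transport along `𝒪_{Z′,q} ≅ 𝒪_{X₁,x}`.
* `pointFixAtNonClosedOfRegular_of_cp` — strat-1's `PointFixAtNonClosedOfRegular` binders VERBATIM (all `dim 𝒪_η ≤ 3`), conclusion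
  `PointFixData` unfolded with `SliceableCentre.FullCl`; supersedes `pointFixAtNonClosedOfRegular_dimThree`.
[folklore assembly; cite: CossartPiltant2019, Thm. 1.1; StacksProject, Tag 0804, Tag 0805 and Tag 01J7]
-/

-- single-problem summit: the doubled namespace component is forced
set_option linter.dupNamespace false

noncomputable section

open CategoryTheory CategoryTheory.Limits AlgebraicGeometry TopologicalSpace IsLocalRing Order
open Literature.AlgebraicGeometry.Resolution Literature.AlgebraicGeometry.CossartPiltant200819

namespace Summit.ResolutionOfSingularities.ResolutionOfSingularities.Theorems.FInjectiveMacaulayfication.PointFixOfRegularGenerizationsLowDim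

open Summit.ResolutionOfSingularities.ResolutionOfSingularities.Theorems.FInjectiveMacaulayfication
open PointFixOfRegularGenerizations RegularOffCodimFourResidue

/-- **`PFix` AT A NON-REGULAR POINT OF LOCAL DIMENSION `≤ 3` WITH REGULAR PROPER GENERIZATIONS** (door v30 rung (T1-reg) at every
local dimension, by the SPECIALISATION TRICK of res-L1-w45a-plan-1 R15.27 (3)): `X₁` integral of finite type over a field `k` of
characteristic `p` with `3 ≤ dim X₁`, `x ∈ X₁` with `dim 𝒪_{X₁,x} ≤ 3`, `𝒪_{X₁,x}` not regular, all proper generizations of `x` regular.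
Choose a specialisation `x′` of `x` with `dim 𝒪_{X₁,x′} = 3` (`exists_specializes_ringKrullDim_stalk_eq`); Cossart–Piltant blows up
`Z′ = Spec 𝒪_{X₁,x′}` to a regular `T` along `𝓛` with `Supp 𝓛 = Sing Z′`; the point `q ∈ Z′` under `x` is singular (local rings agree
along `Spec 𝒪_{X₁,x′} → X₁`) and is a MAXIMAL point of `Supp 𝓛` (its proper generizations lie under proper generizations of `x`); so
`𝒪_{Z′,q} ≅ 𝒪_{X₁,x}` is point-fixable by `pfixAt_stalk_of_isBlowup_of_isRegular`. Modulo the three threefold named facts.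
[folklore assembly; cite: CossartPiltant2019, Thm. 1.1; StacksProject, Tag 0804, Tag 0805 and Tag 01J7] -/
theorem pfix_of_isRegularLocalRing_generizations_of_le
    (hG : CossartPiltant2019General.{0}) (h081R : Stacks081R.{0}) (hP : CossartPiltant2019Principalization.{0})
    (p : ℕ) [Fact p.Prime] {k : Type} [Field k] [CharP k p]
    {X₁ : Scheme.{0}} (f₁ : X₁ ⟶ Spec (.of k)) [LocallyOfFiniteType f₁] [QuasiCompact f₁] [IsIntegral X₁]
    (h3 : (3 : WithBot ℕ∞) ≤ topologicalKrullDim X₁) (x : X₁)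
    (hdim : ringKrullDim (X₁.presheaf.stalk x) ≤ (3 : ℕ))
    (hreg : ∀ y : X₁, y ⤳ x → y ≠ x → IsRegularLocalRing (X₁.presheaf.stalk y))
    (hbad : ¬ IsRegularLocalRing (X₁.presheaf.stalk x)) :
    TameWildSplit.PFixData p (X₁.presheaf.stalk x) := by
  classical
  have hp : p.Prime := Fact.out
  haveI : IsLocallyNoetherian X₁ := LocallyOfFiniteType.isLocallyNoetherian f₁
  haveI : CompactSpace X₁ := QuasiCompact.compactSpace_of_compactSpace f₁
  -- a specialisation `x′` of `x` of local dimension `3`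
  obtain ⟨d₀, hd₀⟩ := exists_topologicalKrullDim_le_of_locallyOfFiniteType f₁
  obtain ⟨d, hd⟩ := exists_topologicalKrullDim_eq_nat hd₀
  have h3d : 3 ≤ d := by
    rw [hd] at h3
    exact_mod_cast h3
  obtain ⟨x', hxx', hx'3⟩ := exists_specializes_ringKrullDim_stalk_eq f₁ hd x hdim h3d
  -- the local scheme `Z′ = Spec 𝒪_{X₁,x′}` and its point `q` under `x`
  obtain ⟨q, hq⟩ : x ∈ Set.range (X₁.fromSpecStalk x').base := by
    rw [Scheme.range_fromSpecStalk]
    exact hxx'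
  haveI : Flat (X₁.fromSpecStalk x') := flat_fromSpecStalk X₁ x'
  -- Cossart–Piltant at `Z′`
  have hqe : Scheme.IsQuasiExcellent (Spec (X₁.presheaf.stalk x')) := isQuasiExcellent_Spec_stalk f₁ x'
  have hdimZ : topologicalKrullDim ↥(Spec (X₁.presheaf.stalk x')) = 3 := by
    have h := PrimeSpectrum.topologicalKrullDim_eq_ringKrullDim (R := X₁.presheaf.stalk x')
    rw [hx'3] at h
    exact h
  obtain ⟨𝓛, T, ρ, -, hρ, hT, U, hU, hsupp, -⟩ :=
    CP2019.exists_isBlowup_isRegular_of_dim_three_of_isQuasiExcellent hG h081R hP hqe hdimZ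
  have hsupp₀ : (𝓛.support : Set ↥(Spec (X₁.presheaf.stalk x'))) ⊆ (Scheme.regularLocus (Spec (X₁.presheaf.stalk x')))ᶜ := by
    rw [← hU]; exact hsupp
  have hSuppEq := CP2019.support_eq_compl_regularLocus_of_isBlowup_of_isRegular hρ hT hsupp₀
  -- `q` is a singular point of `Z′`, maximal in `Supp 𝓛`
  have hqsing : q ∈ (𝓛.support : Set ↥(Spec (X₁.presheaf.stalk x'))) := by
    rw [hSuppEq]
    intro hqreg
    have := (mem_regularLocus_iff_of_flat_of_isPreimmersion (X₁.fromSpecStalk x') q).mp hqreg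
    rw [hq] at this
    exact hbad this
  have hmax : q ∈ maxPoints (𝓛.support : Set ↥(Spec (X₁.presheaf.stalk x'))) := by
    refine mem_maxPoints_iff.mpr ⟨hqsing, fun r hr hrq => ?_⟩
    by_contra hne
    have hy : (X₁.fromSpecStalk x').base r ⤳ x := hq ▸ hrq.map (X₁.fromSpecStalk x').continuous
    have hyne : (X₁.fromSpecStalk x').base r ≠ x := by
      intro h
      exact hne ((X₁.fromSpecStalk x').isEmbedding.injective (h.trans hq.symm))
    have hrreg : r ∈ Scheme.regularLocus (Spec (X₁.presheaf.stalk x')) :=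
      (mem_regularLocus_iff_of_flat_of_isPreimmersion (X₁.fromSpecStalk x') r).mpr (hreg _ hy hyne)
    rw [hSuppEq] at hr
    exact hr hrreg
  -- `𝔪_q ≠ 0`: otherwise `𝒪_{Z′,q}` is a field, hence regular, and so is `𝒪_{X₁,x}`
  haveI := isIso_stalkMap_of_flat_of_isPreimmersion (X₁.fromSpecStalk x') q
  let e₁ : X₁.presheaf.stalk ((X₁.fromSpecStalk x').base q) ≃+* (Spec (X₁.presheaf.stalk x')).presheaf.stalk q :=
    (asIso ((X₁.fromSpecStalk x').stalkMap q)).commRingCatIsoToRingEquiv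
  let e₂ : X₁.presheaf.stalk ((X₁.fromSpecStalk x').base q) ≃+* X₁.presheaf.stalk x :=
    (X₁.presheaf.stalkCongr (Inseparable.of_eq hq)).commRingCatIsoToRingEquiv
  let e : (Spec (X₁.presheaf.stalk x')).presheaf.stalk q ≃+* X₁.presheaf.stalk x := e₁.symm.trans e₂
  have hpos : maximalIdeal ((Spec (X₁.presheaf.stalk x')).presheaf.stalk q) ≠ ⊥ := by
    intro hm
    have hF := IsLocalRing.isField_iff_maximalIdeal_eq.mpr hm
    letI := hF.toField
    haveI : IsRegularLocalRing ((Spec (X₁.presheaf.stalk x')).presheaf.stalk q) := inferInstance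
    exact hbad (IsRegularLocalRing.of_ringEquiv e)
  -- characteristic bookkeeping: `k → 𝒪_{Z′,q}`
  let φ : k →+* (Spec (X₁.presheaf.stalk x')).presheaf.stalk q :=
    e.symm.toRingHom.comp ((X₁.presheaf.germ ⊤ x trivial).hom.comp (f₁.appTop.hom.comp (Scheme.ΓSpecIso (.of k)).inv.hom))
  have hO := pfixAt_stalk_of_isBlowup_of_isRegular p hρ hT q hmax hpos φ
  exact PointFixableTransport.pointFixable_of_ringEquiv p e hO

/-- **RUNG `PointFixAtNonClosedOfRegular`, ALL LOCAL DIMENSIONS `≤ 3`** (res-L1-w45a-strat-1 `FC2Dim4Sig.lean` v0.3 §2, binders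
verbatim; conclusion = `∃ n′ c′, PointFixData p X₁ η n′ c′` unfolded with `SliceableCentre.FullCl`): supersedes
`PointFixOfRegularGenerizations.pointFixAtNonClosedOfRegular_dimThree`. Modulo the three threefold named facts.
[folklore assembly; cite: CossartPiltant2019, Thm. 1.1; StacksProject, Tag 0804 and Tag 0805] -/
theorem pointFixAtNonClosedOfRegular_of_cp
    (hG : CossartPiltant2019General.{0}) (h081R : Stacks081R.{0}) (hP : CossartPiltant2019Principalization.{0}) :
    ∀ (p : ℕ), p.Prime → ∀ (k : Type) [Field k] [CharP k p]
    (X₁ : Scheme.{0}) (f₁ : X₁ ⟶ Spec (.of k)),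
      IsSeparated f₁ → LocallyOfFiniteType f₁ → QuasiCompact f₁ → IsIntegral X₁ → 4 ≤ topologicalKrullDim X₁ →
      (∀ x : X₁, SliceableCentre.CMCl (X₁.presheaf.stalk x)) →
      ∀ η : X₁, ¬ IsClosed ({η} : Set X₁) → ¬ SliceableCentre.FCl p (X₁.presheaf.stalk η) →
        ringKrullDim (X₁.presheaf.stalk η) ≤ 3 →
        (∀ y : X₁, y ⤳ η → y ≠ η → IsRegularLocalRing (X₁.presheaf.stalk y)) →
        ∃ (n' : ℕ) (c' : Fin n' → X₁.presheaf.stalk η),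
          (Ideal.span (Set.range c') ≠ ⊥ ∧ Ideal.span (Set.range c') ≤ maximalIdeal (X₁.presheaf.stalk η) ∧
            ∀ (j : Fin n') (𝔔 : PrimeSpectrum (blowupAlgebra (Ideal.span (Set.range c')) (c' j))),
              𝔔.asIdeal.comap (algebraMap (X₁.presheaf.stalk η) (blowupAlgebra (Ideal.span (Set.range c')) (c' j))) =
                maximalIdeal (X₁.presheaf.stalk η) → SliceableCentre.FullCl p (Localization.AtPrime 𝔔.asIdeal)) ∧
          (Ideal.span (Set.range c')).radical = maximalIdeal (X₁.presheaf.stalk η) := by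
  intro p hp k _ _ X₁ f₁ _ hft hqc hint h4 _ η _ hbad hdim hreg
  haveI := hft
  haveI := hqc
  haveI := hint
  haveI : Fact p.Prime := ⟨hp⟩
  have hnreg : ¬ IsRegularLocalRing (X₁.presheaf.stalk η) := by
    intro hreg'
    haveI := hreg'
    haveI : CharP (X₁.presheaf.stalk η) p :=
      CharP.of_ringHom_of_ne_zero
        ((X₁.presheaf.germ ⊤ η trivial).hom.comp (f₁.appTop.hom.comp (Scheme.ΓSpecIso (.of k)).inv.hom)) p hp.ne_zero
    exact hbad fun d hd s hs => ((FiClauseOfRegular.stub_fiClauseOfRegular p (X₁.presheaf.stalk η)).2 d hd s hs).2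
  have h3 : (3 : WithBot ℕ∞) ≤ topologicalKrullDim X₁ := le_trans (by exact_mod_cast (show (3 : ℕ) ≤ 4 by norm_num)) h4
  have hdim' : ringKrullDim (X₁.presheaf.stalk η) ≤ (3 : ℕ) := hdim
  obtain ⟨n, c, hne, hrad, hcl⟩ :=
    pfix_of_isRegularLocalRing_generizations_of_le hG h081R hP p f₁ h3 η hdim' hreg hnreg
  refine ⟨n, c, ⟨hne, ?_, fun j 𝔔 h𝔔 => hcl j 𝔔 h𝔔⟩, hrad⟩
  rw [← hrad]
  exact Ideal.le_radical

end Summit.ResolutionOfSingularities.ResolutionOfSingularities.Theorems.FInjectiveMacaulayfication.PointFixOfRegularGenerizationsLowDim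

end
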